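import Summits.KontsevichZagierPeriods.Zeta5Search.SymmetricFamilyRecursion
import Summits.KontsevichZagierPeriods.Zeta5Search.SymmetricFamilyMargin
import Summits.KontsevichZagierPeriods.Zeta5Search.NearMissNoCertificate
import HarnessLib

/-!
# ζ(5) search — the symmetric family after the discharge of `Q_solvesRec` (cell `pub-zeta5`, P1)

HONEST FRAMING: systematic search; no irrationality claim unless certified.

With `SymmetricRecursion.Q_solvesRec_holds` (the Brown–Zudilin double sum (7) satisfies the Sect. 2
recursion for all `n`, `SymmetricFamilyRecursion.lean`) the hypothesis `Q_solvesRec` disappears from the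
cell's statements about the totally symmetric family:

* `Q_eq_Qsol` — `Q_n = Qsol_n` for ALL `n` (the binomial sum IS the recursion solution with data
  `1, 21, 2989`; previously kernel-checked for `n ≤ 31` only);
* `zudilin_q_eq` — Zudilin's denominators (Mat. Zametki 2002, solution `q_n` of recursion (1)) are the
  explicit double binomial sums `q_n = (-1)^{n+1} binom(2n,n) Q_n` for all `n`;
* `forms_ne_zero`, `forms_eventually_ne_zero`, `scaled_forms_rate`, `margin_lt`, `no_certificate` — the
  results of `SymmetricFamilyMargin.lean` / `NearMissNoCertificate.lean` conditional only on the two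
  PUBLISHED analytic facts `BrownZudilin2022.rates` and `Zudilin2002.theorem1_signs` (named facts), no longer
  on the computer-verified recursion.
-/

noncomputable section

namespace Summit.KontsevichZagierPeriods.Zeta5Search.SymmetricRecursion

open Filter
open scoped Topology
open Literature.NumberTheory.Irrationality
open Literature.NumberTheory.Irrationality.BrownZudilin2022
open Literature.NumberTheory.Transcendental (zetaValue)

/-- **`Q_n = Qsol_n` for all `n`**: the double binomial sum (7) is the solution of the Sect. 2 recursion
with initial data `1, 21, 2989` (unconditional). -/
theorem Q_eq_Qsol (n : ℕ) : (Q n : ℚ) = Qsol n :=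
  SymmetricFamily.Q_eq_Qsol_of_solvesRec Q_solvesRec_holds n

/-- **Zudilin's `q_n` as a double binomial sum**, all `n`: `q_n = (-1)^{n+1} binom(2n,n) Q_n`. -/
theorem zudilin_q_eq (n : ℕ) :
    Zudilin2002.q n = (-1) ^ (n + 1) * (Nat.centralBinom n : ℚ) * (Q n : ℚ) := by
  rw [congrFun q_eq_gauge n]
  unfold BrownZudilin2022.gauge
  rw [Q_eq_Qsol]

/-- Non-vanishing `Q_nζ(5) - P_n ≠ 0` (`n ≥ 1`) from Zudilin's Theorem 1 (signs) alone. -/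
theorem forms_ne_zero (hs : Zudilin2002.theorem1_signs) {n : ℕ} (hn : 1 ≤ n) :
    (Q n : ℝ) * zetaValue 5 - (P n : ℝ) ≠ 0 :=
  SymmetricFamily.forms_ne_zero hs Q_solvesRec_holds hn

/-- Eventual non-vanishing of the forms, from Zudilin's Theorem 1 (signs) alone. -/
theorem forms_eventually_ne_zero (hs : Zudilin2002.theorem1_signs) :
    ∀ᶠ n : ℕ in atTop, (Q n : ℝ) * zetaValue 5 - (P n : ℝ) ≠ 0 :=
  SymmetricFamily.forms_eventually_ne_zero hs Q_solvesRec_holds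

/-- **Growth of the integer-normalised forms** `log(d_n⁵|Q_nζ(5) - P_n|)/n → r ∈ (2.527, 2.528)`, conditional
on the published rates and signs only. -/
theorem scaled_forms_rate (h : rates) (hs : Zudilin2002.theorem1_signs) :
    ∃ r : ℝ, (2527 / 1000 : ℝ) < r ∧ r < 2528 / 1000 ∧
      Tendsto (fun n : ℕ =>
        Real.log ((Nat.lcmUpto n : ℝ) ^ 5 * |(Q n : ℝ) * zetaValue 5 - (P n : ℝ)|) / n) atTop (𝓝 r) :=
  SymmetricFamily.scaled_forms_rate h (forms_eventually_ne_zero hs)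

/-- **Margin**: any admissible decay exponent `c` and denominator exponent `δ` satisfy `c - δ < -2.527`
(published rates and signs only). -/
theorem margin_lt (h : rates) (hs : Zudilin2002.theorem1_signs) {c δ : ℝ}
    (hc : ∀ᶠ n : ℕ in atTop, |(Q n : ℝ) * zetaValue 5 - (P n : ℝ)| ≤ Real.exp (-(c * n)))
    (hδ : ∀ᶠ n : ℕ in atTop, ((Nat.lcmUpto n : ℝ)) ^ 5 ≤ Real.exp (δ * n)) :
    c - δ < -(2527 / 1000) :=
  SymmetricFamily.margin_lt h (forms_eventually_ne_zero hs) hc hδ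

/-- **No certificate** from the symmetric family with denominators `12 d_n⁵` and bounded savings
(published rates and signs only). -/
theorem no_certificate (h : rates) (hs : Zudilin2002.theorem1_signs) (K : ℕ) :
    ¬ ∃ cert : LinearFormCertificate (zetaValue 5),
        (∀ n, cert.form n = (Q n : ℝ) * zetaValue 5 - (P n : ℝ))
        ∧ (∀ n, cert.denom n = 12 * Nat.lcmUpto n ^ 5) ∧ (∀ n, cert.saving n ≤ K) :=
  no_certificate_symmetric h (forms_eventually_ne_zero hs) K

end Summit.KontsevichZagierPeriods.Zeta5Search.SymmetricRecursion
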